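import Mathlib
import HarnessLib
import Summits.NavierStokesRegularity.NavierStokesRegularity.Theses.AdaptedFrequency
import Literature.Analysis.FluidPDE.AdaptedBackwardKernel
import Literature.Analysis.FluidPDE.RadialCalculus

/-!
# Sketch — crux-ideate round 1, ideator 3, crux `AdaptedFrequency.AdaptedKernelExists`
(item stmt-NavierStokesRegularity-2956)

Typed first lemmas of the two idea cards of this seat (statements only; nothing is proved here
except two sanity checks):

* card `pole-forgetting-doeblin`: `PassiveScalarsForgetThePole` (the lever), `KernelIsPoleEvaluation`
  (duality identity + continuity at the pole), `AdaptedKernelUnique` (by-product: uniqueness of the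
  comparable adapted kernel);
* card `ou-dominance-exterior-barrier`: `ExteriorSuperBarrier`, `ExteriorSubBarrier` (the lever, pure
  calculus in the similarity variable `y`) — BOTH PROVED below (`exteriorSuperBarrier_holds`,
  `exteriorSubBarrier_holds`, via the tree's `laplacian_comp_norm_sq` / `fderiv_comp_norm_sq_apply`),
  `ExteriorBarrierPhysical` (the same in `(t, x)`), `BulkTwoSided` (the compact-bulk input the exterior
  comparison consumes), `NearSharpComparability` (the output).

Shared vocabulary: `IsTypeIDrift` (same shape as the registered lines' abbreviation) and
`IsForwardPassiveScalar` (bounded classical solutions of the FORWARD advection–diffusion equation).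
-/

noncomputable section

open MeasureTheory Set Function Filter Topology
open scoped RealInnerProductSpace Laplacian

namespace Summit.NavierStokesRegularity.NavierStokesRegularity.Cruxes.AdaptedKernelExists.Ideator3

open Literature.Analysis.FluidPDE

/-- `ℝ³`. -/
abbrev E3 := EuclideanSpace ℝ (Fin 3)

/-- Smooth divergence-free drift on `[t₀, T)` with the time-only Type-I bound `‖b(t,x)‖ ≤ C/√(T−t)`
(the shape of the lines' `IsTypeIDrift`). -/
def IsTypeIDrift (C : ℝ) (b : ℝ → E3 → E3) (t₀ T : ℝ) : Prop :=
  IsSmoothSpaceTimeOn (Ico t₀ T) b ∧ (∀ t ∈ Ico t₀ T, VectorCalculus.IsDivFree (b t)) ∧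
    ∀ t ∈ Ico t₀ T, ∀ x, ‖b t x‖ ≤ C / Real.sqrt (T - t)

/-- Bounded classical FORWARD passive scalar on `[t₁, T) × ℝ³`:
`∂ₛq + b·∇q − νΔq = 0`, jointly `C²`, bounded. Its value is transported by the backward
stochastic Lagrangian particle, so `∫ q(s) G(s) dx` is constant for every adapted kernel `G`. -/
def IsForwardPassiveScalar (ν : ℝ) (b : ℝ → E3 → E3) (t₁ T : ℝ) (q : ℝ → E3 → ℝ) : Prop :=
  ContDiffOn ℝ 2 (uncurry q) (Ico t₁ T ×ˢ univ) ∧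
    (∀ s ∈ Ico t₁ T, ∀ x, timeDerivWithin (Ico t₁ T) q s x + fderiv ℝ (q s) x (b s x)
        - ν * Laplacian.laplacian (q s) x = 0) ∧
    ∃ M : ℝ, ∀ s ∈ Ico t₁ T, ∀ x, |q s x| ≤ M

/-! ## Card `pole-forgetting-doeblin` -/

/-- **First lemma (the lever): forward passive scalars forget their data at a Type-I pole.**
For a Type-I divergence-free drift with constant `C` and a bounded forward passive scalar `q` on
`[t₁, T)`, `q(s, ·)` converges to a constant `ℓ` at the singular point, uniformly on the parabolic
bulks `‖x − x₀‖ ≤ R√(T−s)`, at a HÖLDER rate in `(T−s)/(T−t₁)` — i.e. geometrically in the number of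
dyadic blocks crossed — with `κ, K` depending on `(ν, C, R)` only (Doeblin–Harris contraction:
minorization on the bulk from one-block spread of positivity at bounded rescaled drift, Lyapunov
function `‖x−x₀‖²/(T−t)`). -/
def PassiveScalarsForgetThePole : Prop :=
  ∀ (ν C R : ℝ), 0 < ν → 0 ≤ C → 0 < R → ∃ κ K : ℝ, 0 < κ ∧ 0 < K ∧
    ∀ (t₀ t₁ T M : ℝ) (b : ℝ → E3 → E3) (x₀ : E3) (q : ℝ → E3 → ℝ),
      t₀ ≤ t₁ → t₁ < T → IsTypeIDrift C b t₀ T → IsForwardPassiveScalar ν b t₁ T q →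
      (∀ s ∈ Ico t₁ T, ∀ x, |q s x| ≤ M) →
      ∃ ℓ : ℝ, ∀ s ∈ Ico t₁ T, ∀ x : E3, ‖x - x₀‖ ≤ R * Real.sqrt (T - s) →
        |q s x - ℓ| ≤ K * M * ((T - s) / (T - t₁)) ^ κ

/-- **Duality identity + continuity at the pole.** For an adapted, Gaussian-comparable kernel `G`
at `(T, x₀)` and a bounded forward passive scalar `q` on `[t₁, T)`, the pairing `∫ q(s) G(s)` is
constant in `s` and equals the limit of `q` at the pole: `q(s, x₀) → ∫ q(t₁) G(t₁)` as `s ↑ T`.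
(This is what makes the kernel the Riesz representer of "evaluate the forward solution at the
pole", and is the bridge from `PassiveScalarsForgetThePole` to existence AND uniqueness.) -/
def KernelIsPoleEvaluation : Prop :=
  ∀ (ν C t₀ t₁ T : ℝ) (b : ℝ → E3 → E3) (x₀ : E3) (G q : ℝ → E3 → ℝ),
    0 < ν → 0 ≤ C → t₀ ≤ t₁ → t₁ < T → IsTypeIDrift C b t₀ T →
    IsAdaptedBackwardKernel ν b (Ico t₀ T) T x₀ G → IsGaussianComparable G (Ico t₀ T) T x₀ →
    IsForwardPassiveScalar ν b t₁ T q →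
    (∀ s ∈ Ico t₁ T, ∫ x, q s x * G s x = ∫ x, q t₁ x * G t₁ x) ∧
      Tendsto (fun s => q s x₀) (𝓝[<] T) (𝓝 (∫ x, q t₁ x * G t₁ x))

/-- **By-product: uniqueness.** Two adapted kernels at the same pole for the same Type-I drift, both
Gaussian-comparable (tightness at the parabolic scale is what is used), coincide. -/
def AdaptedKernelUnique : Prop :=
  ∀ (ν C t₀ T : ℝ) (b : ℝ → E3 → E3) (x₀ : E3) (G G' : ℝ → E3 → ℝ),
    0 < ν → 0 ≤ C → t₀ < T → IsTypeIDrift C b t₀ T →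
    IsAdaptedBackwardKernel ν b (Ico t₀ T) T x₀ G → IsGaussianComparable G (Ico t₀ T) T x₀ →
    IsAdaptedBackwardKernel ν b (Ico t₀ T) T x₀ G' → IsGaussianComparable G' (Ico t₀ T) T x₀ →
    ∀ t ∈ Ico t₀ T, ∀ x, G t x = G' t x

/-! ## Card `ou-dominance-exterior-barrier` -/

/-- The radial Gaussian `Ψₐ(y) = e^{−a‖y‖²}` in the similarity variable `y = (x − x₀)/√(T−t)`. -/
def gaussBarrier (a : ℝ) (y : E3) : ℝ := Real.exp (-a * ‖y‖ ^ 2)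

/-- **First lemma (the lever), upper side.** In similarity variables the kernel solves the
Fokker–Planck equation `Φ_σ = νΔΦ + (y/2 + U)·∇Φ + (3/2)Φ` (`σ = log(T−t)`, `div U = 0`,
`‖U‖ ≤ C` = the Type-I constant). For every `a < 1/(4ν)` the WIDER Gaussian `Ψₐ` is a stationary
SUPERsolution outside a ball, simultaneously for every admissible drift value `U`:
`νΔΨₐ + (y/2 + U)·∇Ψₐ + (3/2)Ψₐ ≤ 0` for `‖y‖ ≥ R(ν, C, a)` (the Ornstein–Uhlenbeck pull `y/2`
dominates the bounded perturbation: `Ψₐ⁻¹·LHS = (4νa² − a)‖y‖² + (3/2 − 6νa) − 2a⟪U, y⟫`). -/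
def ExteriorSuperBarrier : Prop :=
  ∀ (ν C a : ℝ), 0 < ν → 0 ≤ C → 0 < a → a < 1 / (4 * ν) → ∃ R : ℝ, 0 < R ∧
    ∀ (y U : E3), R ≤ ‖y‖ → ‖U‖ ≤ C →
      ν * Laplacian.laplacian (gaussBarrier a) y
        + fderiv ℝ (gaussBarrier a) y ((1 / 2 : ℝ) • y + U) + (3 / 2 : ℝ) * gaussBarrier a y ≤ 0

/-- **First lemma (the lever), lower side.** For every `a > 1/(4ν)` the NARROWER Gaussian `Ψₐ` is
a stationary SUBsolution outside a ball, for every admissible `U` at once. -/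
def ExteriorSubBarrier : Prop :=
  ∀ (ν C a : ℝ), 0 < ν → 0 ≤ C → 1 / (4 * ν) < a → ∃ R : ℝ, 0 < R ∧
    ∀ (y U : E3), R ≤ ‖y‖ → ‖U‖ ≤ C →
      0 ≤ ν * Laplacian.laplacian (gaussBarrier a) y
        + fderiv ℝ (gaussBarrier a) y ((1 / 2 : ℝ) • y + U) + (3 / 2 : ℝ) * gaussBarrier a y

/-- The same barriers in physical variables: `Ψ(t, x) = (T−t)^{-3/2} e^{−a‖x−x₀‖²/(T−t)}` is a
supersolution (`a < 1/(4ν)`), resp. subsolution (`a > 1/(4ν)`), of the adjoint equation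
`∂ₜΨ + u·∇Ψ + νΔΨ = 0` on the exterior parabolic region `‖x − x₀‖ ≥ R√(T−t)`, for EVERY velocity
value with `‖u(t,x)‖ ≤ C/√(T−t)`. -/
def physBarrier (a T : ℝ) (x₀ : E3) (t : ℝ) (x : E3) : ℝ :=
  (T - t) ^ (-(3 : ℝ) / 2) * Real.exp (-a * ‖x - x₀‖ ^ 2 / (T - t))

def ExteriorBarrierPhysical : Prop :=
  ∀ (ν C a : ℝ), 0 < ν → 0 ≤ C → 0 < a → a ≠ 1 / (4 * ν) → ∃ R : ℝ, 0 < R ∧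
    ∀ (T : ℝ) (x₀ : E3) (t : ℝ) (x v : E3), t < T → R * Real.sqrt (T - t) ≤ ‖x - x₀‖ →
      ‖v‖ ≤ C / Real.sqrt (T - t) →
      (a < 1 / (4 * ν) →
        deriv (fun s => physBarrier a T x₀ s x) t + fderiv ℝ (physBarrier a T x₀ t) x v
          + ν * Laplacian.laplacian (physBarrier a T x₀ t) x ≤ 0) ∧
      (1 / (4 * ν) < a →
        0 ≤ deriv (fun s => physBarrier a T x₀ s x) t + fderiv ℝ (physBarrier a T x₀ t) x v
          + ν * Laplacian.laplacian (physBarrier a T x₀ t) x)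

/-- **Bulk input** consumed by the exterior comparison (compact similarity bulk = bounded drift,
`O(1)` constants, no chain toward the pole): a priori, an adapted Gaussian-comparable kernel of a
Type-I drift is bounded above AND below by constants depending on `(ν, C, R)` only on the
parabolic bulk `‖x − x₀‖ ≤ R√(T−t)`, after the scale factor `(T−t)^{3/2}`. -/
def BulkTwoSided : Prop :=
  ∀ (ν C R : ℝ), 0 < ν → 0 ≤ C → 0 < R → ∃ m₀ M₀ : ℝ, 0 < m₀ ∧ 0 < M₀ ∧
    ∀ (t₀ T : ℝ) (b : ℝ → E3 → E3) (x₀ : E3) (G : ℝ → E3 → ℝ), t₀ < T → IsTypeIDrift C b t₀ T →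
      IsAdaptedBackwardKernel ν b (Ico t₀ T) T x₀ G → IsGaussianComparable G (Ico t₀ T) T x₀ →
      ∀ t ∈ Ico ((t₀ + T) / 2) T, ∀ x, ‖x - x₀‖ ≤ R * Real.sqrt (T - t) →
        m₀ ≤ (T - t) ^ ((3 : ℝ) / 2) * G t x ∧ (T - t) ^ ((3 : ℝ) / 2) * G t x ≤ M₀

/-- **What the exterior comparison delivers**: near-sharp widths. For every `ε > 0` the a-priori
two-sided bound holds with Gaussian widths `4ν(1+ε)` above and `4ν(1−ε)` below (constants
`c₁, C₁` depending on `(ν, C, ε)`). -/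
def NearSharpComparability : Prop :=
  ∀ (ν C ε : ℝ), 0 < ν → 0 ≤ C → 0 < ε → ε < 1 → ∃ c₁ C₁ : ℝ, 0 < c₁ ∧ 0 < C₁ ∧
    ∀ (t₀ T : ℝ) (b : ℝ → E3 → E3) (x₀ : E3) (G : ℝ → E3 → ℝ), t₀ < T → IsTypeIDrift C b t₀ T →
      IsAdaptedBackwardKernel ν b (Ico t₀ T) T x₀ G → IsGaussianComparable G (Ico t₀ T) T x₀ →
      ∀ t ∈ Ico ((t₀ + T) / 2) T, ∀ x,
        c₁ * (T - t) ^ (-(3 : ℝ) / 2) * Real.exp (-(‖x - x₀‖ ^ 2) / (4 * ν * (1 - ε) * (T - t)))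
            ≤ G t x ∧
          G t x ≤
            C₁ * (T - t) ^ (-(3 : ℝ) / 2) * Real.exp (-(‖x - x₀‖ ^ 2) / (4 * ν * (1 + ε) * (T - t)))

/-! ## Card `ou-dominance-exterior-barrier`: the first lemma PROVED -/

/-- Radial profile `s ↦ e^{−a s}` and its derivative. -/
theorem hasDerivAt_gprof (a σ : ℝ) :
    HasDerivAt (fun s : ℝ => Real.exp (-a * s)) (-a * Real.exp (-a * σ)) σ := by
  have h : HasDerivAt (fun s : ℝ => -a * s) (-a) σ := by
    simpa using (hasDerivAt_id σ).const_mul (-a)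
  exact h.exp.congr_deriv (by ring)

theorem hasDerivAt_gprof₁ (a σ : ℝ) :
    HasDerivAt (fun s : ℝ => -a * Real.exp (-a * s)) (a ^ 2 * Real.exp (-a * σ)) σ := by
  exact ((hasDerivAt_gprof a σ).const_mul (-a)).congr_deriv (by ring)

/-- `Δ e^{−a‖y‖²} = (4a²‖y‖² − 6a) e^{−a‖y‖²}` on `ℝ³` (tree `laplacian_comp_norm_sq`). -/
theorem laplacian_gaussBarrier (a : ℝ) (y : E3) :
    (Δ (gaussBarrier a)) y = (4 * a ^ 2 * ‖y‖ ^ 2 - 6 * a) * Real.exp (-a * ‖y‖ ^ 2) := by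
  unfold gaussBarrier
  rw [laplacian_comp_norm_sq (g := fun s : ℝ => Real.exp (-a * s))
    (g₁ := fun s : ℝ => -a * Real.exp (-a * s)) isOpen_univ (fun σ _ => hasDerivAt_gprof a σ)
    (Set.mem_univ _) (hasDerivAt_gprof₁ a (‖y‖ ^ 2))]
  rw [finrank_euclideanSpace_fin]
  push_cast
  ring

/-- `D(e^{−a‖·‖²})(y)[v] = −2a e^{−a‖y‖²} ⟪y, v⟫` (tree `fderiv_comp_norm_sq_apply`). -/
theorem fderiv_gaussBarrier_apply (a : ℝ) (y v : E3) :
    fderiv ℝ (gaussBarrier a) y v = 2 * (-a * Real.exp (-a * ‖y‖ ^ 2)) * ⟪y, v⟫ := by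
  unfold gaussBarrier
  exact fderiv_comp_norm_sq_apply (hasDerivAt_gprof a (‖y‖ ^ 2)) v

theorem inner_half_add (y U : E3) :
    ⟪y, (1 / 2 : ℝ) • y + U⟫ = 1 / 2 * ‖y‖ ^ 2 + ⟪y, U⟫ := by
  rw [inner_add_right, inner_smul_right, real_inner_self_eq_norm_sq]

/-- **PROVED: the upper exterior barrier.** For `a < 1/(4ν)` and
`R = max 1 ((2aC + 3/2)/(a(1 − 4νa)))`, `νΔΨₐ + ⟪y/2 + U, ∇Ψₐ⟫ + (3/2)Ψₐ ≤ 0` whenever `‖y‖ ≥ R`,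
`‖U‖ ≤ C`. -/
theorem exteriorSuperBarrier_holds : ExteriorSuperBarrier := by
  intro ν C a hν hC ha hlt
  have h4 : 4 * ν * a < 1 := by
    have h4ν : 0 < 4 * ν := by positivity
    have := (lt_div_iff₀ h4ν).mp hlt
    linarith
  have hκ : 0 < a * (1 - 4 * ν * a) := mul_pos ha (by linarith)
  refine ⟨max 1 ((2 * a * C + 3 / 2) / (a * (1 - 4 * ν * a))),
    lt_max_iff.2 (Or.inl one_pos), ?_⟩
  intro y U hy hU
  have hr1 : 1 ≤ ‖y‖ := le_trans (le_max_left _ _) hy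
  have hrR : (2 * a * C + 3 / 2) / (a * (1 - 4 * ν * a)) ≤ ‖y‖ := le_trans (le_max_right _ _) hy
  have hΨ : 0 < Real.exp (-a * ‖y‖ ^ 2) := Real.exp_pos _
  have hyU : -⟪y, U⟫ ≤ ‖y‖ * C := by
    have h1 := abs_real_inner_le_norm y U
    have h2 : ‖y‖ * ‖U‖ ≤ ‖y‖ * C := mul_le_mul_of_nonneg_left hU (norm_nonneg _)
    linarith [neg_abs_le (⟪y, U⟫)]
  have hkey : a * (1 - 4 * ν * a) * ‖y‖ ^ 2 ≥ 2 * a * C * ‖y‖ + 3 / 2 := by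
    have h1 : 2 * a * C + 3 / 2 ≤ ‖y‖ * (a * (1 - 4 * ν * a)) := (div_le_iff₀ hκ).mp hrR
    have h2 : (2 * a * C + 3 / 2) * ‖y‖ ≤ (‖y‖ * (a * (1 - 4 * ν * a))) * ‖y‖ :=
      mul_le_mul_of_nonneg_right h1 (by linarith)
    have h3 : 2 * a * C * ‖y‖ + 3 / 2 ≤ (2 * a * C + 3 / 2) * ‖y‖ := by nlinarith
    nlinarith
  have hbr : ν * (4 * a ^ 2 * ‖y‖ ^ 2 - 6 * a) - a * ‖y‖ ^ 2 - 2 * a * ⟪y, U⟫ + 3 / 2 ≤ 0 := by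
    have haC : -(2 * a * ⟪y, U⟫) ≤ 2 * a * C * ‖y‖ := by nlinarith [hyU, ha.le]
    nlinarith [hkey, haC, mul_pos hν ha]
  rw [laplacian_gaussBarrier, fderiv_gaussBarrier_apply, inner_half_add]
  unfold gaussBarrier
  calc _ = Real.exp (-a * ‖y‖ ^ 2) *
        (ν * (4 * a ^ 2 * ‖y‖ ^ 2 - 6 * a) - a * ‖y‖ ^ 2 - 2 * a * ⟪y, U⟫ + 3 / 2) := by ring
    _ ≤ 0 := mul_nonpos_iff.2 (Or.inl ⟨hΨ.le, hbr⟩)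

/-- **PROVED: the lower exterior barrier.** For `a > 1/(4ν)` and
`R = max 1 ((2aC + 6νa)/(a(4νa − 1)))`, `0 ≤ νΔΨₐ + ⟪y/2 + U, ∇Ψₐ⟫ + (3/2)Ψₐ` whenever `‖y‖ ≥ R`,
`‖U‖ ≤ C`. -/
theorem exteriorSubBarrier_holds : ExteriorSubBarrier := by
  intro ν C a hν hC hlt
  have h4ν : 0 < 4 * ν := by positivity
  have h4 : 1 < 4 * ν * a := by
    have := (div_lt_iff₀ h4ν).mp hlt
    linarith
  have ha : 0 < a := by
    have : 0 < 1 / (4 * ν) := by positivity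
    linarith
  have hκ : 0 < a * (4 * ν * a - 1) := mul_pos ha (by linarith)
  refine ⟨max 1 ((2 * a * C + 6 * ν * a) / (a * (4 * ν * a - 1))),
    lt_max_iff.2 (Or.inl one_pos), ?_⟩
  intro y U hy hU
  have hr1 : 1 ≤ ‖y‖ := le_trans (le_max_left _ _) hy
  have hrR : (2 * a * C + 6 * ν * a) / (a * (4 * ν * a - 1)) ≤ ‖y‖ := le_trans (le_max_right _ _) hy
  have hΨ : 0 < Real.exp (-a * ‖y‖ ^ 2) := Real.exp_pos _
  have hyU : ⟪y, U⟫ ≤ ‖y‖ * C := by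
    have h1 := real_inner_le_norm y U
    have h2 : ‖y‖ * ‖U‖ ≤ ‖y‖ * C := mul_le_mul_of_nonneg_left hU (norm_nonneg _)
    linarith
  have hkey : a * (4 * ν * a - 1) * ‖y‖ ^ 2 ≥ 2 * a * C * ‖y‖ + 6 * ν * a := by
    have h1 : 2 * a * C + 6 * ν * a ≤ ‖y‖ * (a * (4 * ν * a - 1)) := (div_le_iff₀ hκ).mp hrR
    have h2 : (2 * a * C + 6 * ν * a) * ‖y‖ ≤ (‖y‖ * (a * (4 * ν * a - 1))) * ‖y‖ :=
      mul_le_mul_of_nonneg_right h1 (by linarith)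
    have hνa : 0 ≤ 6 * ν * a := by positivity
    have h3 : 2 * a * C * ‖y‖ + 6 * ν * a ≤ (2 * a * C + 6 * ν * a) * ‖y‖ := by nlinarith
    nlinarith
  have hbr : 0 ≤ ν * (4 * a ^ 2 * ‖y‖ ^ 2 - 6 * a) - a * ‖y‖ ^ 2 - 2 * a * ⟪y, U⟫ + 3 / 2 := by
    have haC : 2 * a * ⟪y, U⟫ ≤ 2 * a * C * ‖y‖ := by nlinarith [hyU, ha.le]
    nlinarith [hkey, haC]
  rw [laplacian_gaussBarrier, fderiv_gaussBarrier_apply, inner_half_add]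
  unfold gaussBarrier
  calc (0 : ℝ) ≤ Real.exp (-a * ‖y‖ ^ 2) *
        (ν * (4 * a ^ 2 * ‖y‖ ^ 2 - 6 * a) - a * ‖y‖ ^ 2 - 2 * a * ⟪y, U⟫ + 3 / 2) :=
        mul_nonneg hΨ.le hbr
    _ = _ := by ring

/-! ## Sanity checks (proved) -/

/-- The crux unfolds to "∃ t₀, ∃ G adapted ∧ comparable" (the registered lines prove the same). -/
theorem crux_iff :
    Summit.NavierStokesRegularity.NavierStokesRegularity.Theses.AdaptedFrequency.AdaptedKernelExists ↔
      ∀ (ν T : ℝ), 0 < ν → 0 < T → ∀ (u : ℝ → E3 → E3) (p : ℝ → E3 → ℝ),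
        IsClassicalNSSolutionOn (Ico 0 T) ν 0 u p → IsLerayHopfOn T ν 0 (u 0) u →
        HasRapidSpatialDecay (u 0) → IsTypeIBlowup u T → ∀ x₀ : E3, ∃ t₀ ∈ Ico 0 T,
          ∃ G : ℝ → E3 → ℝ, IsAdaptedBackwardKernel ν u (Ico t₀ T) T x₀ G ∧
            IsGaussianComparable G (Ico t₀ T) T x₀ := by
  simp only [Summit.NavierStokesRegularity.NavierStokesRegularity.Theses.AdaptedFrequency.AdaptedKernelExists,
    isAdaptedBackwardKernel_iff, isGaussianComparable_iff_fin_three]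

/-- Near-sharp comparability on the last half of the window implies comparability there
(bookkeeping used when the exterior-barrier line feeds the crux). -/
theorem isGaussianComparable_of_nearSharp {ν c₁ C₁ ε : ℝ} (hν : 0 < ν) (hc₁ : 0 < c₁) (hC₁ : 0 < C₁)
    (hε : 0 < ε) (hε1 : ε < 1) {S : Set ℝ} {T : ℝ} {x₀ : E3} {G : ℝ → E3 → ℝ}
    (h : ∀ t ∈ S, ∀ x,
      c₁ * (T - t) ^ (-(3 : ℝ) / 2) * Real.exp (-(‖x - x₀‖ ^ 2) / (4 * ν * (1 - ε) * (T - t)))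
          ≤ G t x ∧
        G t x ≤
          C₁ * (T - t) ^ (-(3 : ℝ) / 2) * Real.exp (-(‖x - x₀‖ ^ 2) / (4 * ν * (1 + ε) * (T - t)))) :
    IsGaussianComparable G S T x₀ := by
  rw [isGaussianComparable_iff_fin_three]
  refine ⟨c₁, 4 * ν * (1 - ε), C₁, 4 * ν * (1 + ε), hc₁, ?_, hC₁, by positivity, ?_⟩
  · have : 0 < 1 - ε := by linarith
    positivity
  · intro t ht x
    exact h t ht x

end Summit.NavierStokesRegularity.NavierStokesRegularity.Cruxes.AdaptedKernelExists.Ideator3
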